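import Literature.Analysis.Quadrature.SmoothnessClasses
import HarnessLib

/-!
# The foot of the smoothness ladder is not a chain: `C[0, 1] ⊄ BV[0, 1]` (proof of `ContinuousNotBV`)

PROOF LAYER (theorems only) for `Literature/Analysis/Quadrature/SmoothnessClasses.lean` (Davis–Rabinowitz,
*Methods of Numerical Integration*, 2nd ed. 1984, Sect. 1.9): the statement file records as a cited fact
`ContinuousNotBV` that there is a function continuous on `[0, 1]` which is not of bounded variation, naming
the classical witness `x sin(1/x)` without constructing it. Here the witness is constructed and the fact
DISCHARGED (`ContinuousNotBV_holds`): `g(x) = x sin(1/x)` (`g(0) = 0`, automatic in Lean's `1/0 = 0`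
convention) is continuous on `ℝ` (squeeze at `0`), while along the points `x_k = 1/((k + ½)π)` one has
`sin(1/x_k) = (−1)^k`, so consecutive values of `g` alternate in sign, `|g(x_k) − g(x_{k+1})| = x_k + x_{k+1}
≥ 1/((k+2)π)`, and the variation of `g` on `[0, 1]` dominates every partial sum of `Σ 1/((k+2)π)` — a
divergent harmonic tail (`Real.tendsto_sum_range_one_div_nat_succ_atTop`), via `eVariationOn.sum_le`.
-/

open MeasureTheory Set Filter Topology

namespace Literature.Analysis.Quadrature

/-- The classical witness `x ↦ x sin(1/x)` (with `0 ↦ 0`, automatic in Lean since `1/0 = 0`) is continuous on `ℝ`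
(at `0` by `|x sin(1/x)| ≤ |x|`). [cite: DavisRabinowitz1984, Sect. 1.9] -/
theorem continuous_mul_sin_inv : Continuous (fun x : ℝ ↦ x * Real.sin (1 / x)) := by
  rw [continuous_iff_continuousAt]
  intro x
  by_cases hx : x = 0
  · subst hx
    rw [ContinuousAt]
    simp only [div_zero, Real.sin_zero, mul_zero]
    apply squeeze_zero_norm (a := fun x : ℝ ↦ ‖x‖) (fun x ↦ ?_) (by simpa using (continuous_norm.tendsto (0:ℝ)))
    rw [norm_mul]
    exact mul_le_of_le_one_right (norm_nonneg _) (by simpa using Real.abs_sin_le_one (1 / x))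
  · have h1 : ContinuousAt (fun x : ℝ ↦ 1 / x) x := by
      simp_rw [one_div]; exact continuousAt_inv₀ hx
    exact continuousAt_id.mul (Real.continuous_sin.continuousAt.comp h1)

/-- At the sample points `x_k = 1/((k + ½)π)`: `sin(1/x_k) = (−1)^k`. [folklore] -/
private theorem sin_inv_node (k : ℕ) : Real.sin (1 / (1 / (((k : ℝ) + 1 / 2) * Real.pi))) = (-1) ^ k := by
  rw [one_div_one_div, show ((k : ℝ) + 1 / 2) * Real.pi = k * Real.pi + Real.pi / 2 by ring,
    Real.sin_add_pi_div_two, Real.cos_nat_mul_pi]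

/-- `x_k > 0`. [folklore] -/
private theorem node_pos (k : ℕ) : 0 < 1 / (((k : ℝ) + 1 / 2) * Real.pi) := by positivity

/-- `x_k ≤ 1`. [folklore] -/
private theorem node_le_one (k : ℕ) : 1 / (((k : ℝ) + 1 / 2) * Real.pi) ≤ 1 := by
  rw [div_le_one (by positivity)]
  nlinarith [Real.pi_gt_three, (Nat.cast_nonneg k : (0:ℝ) ≤ k)]

/-- Consecutive sample values of `x sin(1/x)` have opposite signs: `|g(x_k) − g(x_{k+1})| = x_k + x_{k+1} ≥ 1/((k+2)π)`.
[folklore] -/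
private theorem abs_sub_nodes (k : ℕ) :
    1 / (((k : ℝ) + 2) * Real.pi) ≤
      |1 / (((k : ℝ) + 1 / 2) * Real.pi) * Real.sin (1 / (1 / (((k : ℝ) + 1 / 2) * Real.pi))) -
        1 / ((((k + 1 : ℕ) : ℝ) + 1 / 2) * Real.pi) * Real.sin (1 / (1 / ((((k + 1 : ℕ) : ℝ) + 1 / 2) * Real.pi)))| := by
  rw [sin_inv_node, sin_inv_node, pow_succ]
  push_cast
  have hpi := Real.pi_pos
  have hk : (0:ℝ) ≤ k := Nat.cast_nonneg k
  have e : 1 / (((k : ℝ) + 1 / 2) * Real.pi) * (-1) ^ k - 1 / (((k : ℝ) + 1 + 1 / 2) * Real.pi) * ((-1) ^ k * -1) =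
      (-1) ^ k * (1 / (((k : ℝ) + 1 / 2) * Real.pi) + 1 / (((k : ℝ) + 1 + 1 / 2) * Real.pi)) := by ring
  rw [e, abs_mul, abs_pow, abs_neg, abs_one, one_pow, one_mul]
  rw [abs_of_pos (by positivity)]
  have h1 : 1 / (((k : ℝ) + 2) * Real.pi) ≤ 1 / (((k : ℝ) + 1 / 2) * Real.pi) :=
    div_le_div_of_nonneg_left zero_le_one (by positivity) (by nlinarith)
  have h2 : 0 ≤ 1 / (((k : ℝ) + 1 + 1 / 2) * Real.pi) := by positivity
  linarith

/-- **`C[0, 1] ⊄ BV[0, 1]`, PROVED** (discharge of the cited fact `ContinuousNotBV`): the classical witness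
`x sin(1/x)` is continuous on `[0, 1]` and its variation along the points `x_k = 1/((k + ½)π)`,
`k = M, …, 0`, is at least `Σ_{k<M} 1/((k+2)π)`, which diverges (harmonic series), so it is not of bounded
variation. [cite: DavisRabinowitz1984, Sect. 1.9] -/
theorem ContinuousNotBV_holds : ContinuousNotBV := by
  refine ⟨fun x ↦ x * Real.sin (1 / x), continuous_mul_sin_inv.continuousOn, fun hBV ↦ ?_⟩
  set g : ℝ → ℝ := fun x ↦ x * Real.sin (1 / x) with hg
  set x : ℕ → ℝ := fun k ↦ 1 / (((k : ℝ) + 1 / 2) * Real.pi) with hx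
  -- x is antitone
  have hx_anti : Antitone x := by
    intro a b hab
    simp only [hx]
    exact div_le_div_of_nonneg_left zero_le_one (by positivity)
      (mul_le_mul_of_nonneg_right (by simpa using hab) Real.pi_pos.le)
  -- the variation along x_M, x_{M-1}, ..., x_0
  have hsum : ∀ M : ℕ, ENNReal.ofReal (∑ i ∈ Finset.range M, 1 / (((i : ℝ) + 2) * Real.pi)) ≤
      eVariationOn g (Icc 0 1) := by
    intro M
    set u : ℕ → ℝ := fun i ↦ x (M - i) with hu
    have hu_mono : Monotone u := fun a b hab ↦ hx_anti (Nat.sub_le_sub_left hab M)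
    have hu_mem : ∀ i, u i ∈ Icc (0:ℝ) 1 := fun i ↦ ⟨(node_pos _).le, node_le_one _⟩
    refine le_trans ?_ (eVariationOn.sum_le (f := g) (n := M) hu_mono hu_mem)
    rw [ENNReal.ofReal_sum_of_nonneg (fun i _ ↦ by positivity)]
    -- reindex i ↦ M - 1 - i
    rw [← Finset.sum_range_reflect]
    refine Finset.sum_le_sum fun i hi ↦ ?_
    rw [Finset.mem_range] at hi
    rw [edist_dist, Real.dist_eq]
    apply ENNReal.ofReal_le_ofReal
    have e1 : M - i = (M - 1 - i) + 1 := by omega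
    have e2 : M - (i + 1) = M - 1 - i := by omega
    simp only [hu, hx, hg, e1, e2]
    have := abs_sub_nodes (M - 1 - i)
    push_cast at this ⊢
    exact this
  -- divergence
  have hdiv : Tendsto (fun M : ℕ ↦ ∑ i ∈ Finset.range M, 1 / (((i : ℝ) + 2) * Real.pi)) atTop atTop := by
    have h := Real.tendsto_sum_range_one_div_nat_succ_atTop
    -- Σ_{i<M} 1/((i+2)π) = (1/π)(Σ_{i<M+1} 1/(i+1) − 1)
    have e : ∀ M : ℕ, ∑ i ∈ Finset.range M, 1 / (((i : ℝ) + 2) * Real.pi) =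
        Real.pi⁻¹ * ((∑ i ∈ Finset.range (M + 1), 1 / ((i : ℝ) + 1)) - 1) := by
      intro M
      rw [Finset.sum_range_succ']
      simp only [Nat.cast_add, Nat.cast_one, CharP.cast_eq_zero, zero_add, div_one, add_sub_cancel_right]
      rw [Finset.mul_sum]
      refine Finset.sum_congr rfl fun i _ ↦ ?_
      field_simp
      ring
    simp_rw [e]
    refine Tendsto.const_mul_atTop (inv_pos.2 Real.pi_pos) ?_
    refine tendsto_atTop_add_const_right _ (-1) ?_ |>.congr (fun M ↦ by ring)
    exact h.comp (tendsto_add_atTop_nat 1)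
  -- contradiction
  have hfin : eVariationOn g (Icc 0 1) ≠ ⊤ := hBV
  obtain ⟨M, hM⟩ := (hdiv.eventually_gt_atTop ((eVariationOn g (Icc 0 1)).toReal)).exists
  have := hsum M
  rw [← ENNReal.ofReal_toReal hfin] at this
  have := (ENNReal.ofReal_le_ofReal_iff ENNReal.toReal_nonneg).1 this
  linarith


end Literature.Analysis.Quadrature
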